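import Summits.ValiantsHypothesis.ValiantsHypothesis.Theorems.FeketeSOSFeketeSOSHardPaleyRIPHankelFourier
import Summits.ValiantsHypothesis.ValiantsHypothesis.Theorems.FeketeSOSFeketeSOSHardPaleyRIPFlatRIPPolarisation
import Mathlib.NumberTheory.LegendreSymbol.QuadraticChar.Basic
import Mathlib.Analysis.SpecialFunctions.Pow.Real
import Mathlib.Analysis.SpecialFunctions.Complex.CircleAddChar
import Literature.NumberTheory.GaussSums.GaussJacobiPrime
import Literature.NumberTheory.GaussSums.BurgessMixedCharacterSums

/-!
# Route FeketeSOS — crux `FeketeSOSHard` (stmt-ValiantsHypothesis-3996), line `paley-rip` (v3),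
# stub `stub_paleyFlatRIP`: the engine HOLDS on supports inside a short arithmetic progression,
# conditionally on the Burgess bound for character sums with a linear phase (Heath-Brown–Pierce 2015)

`…PaleyRIPHankelFourier.lean` reduced the engine inequality `|Q_p(S,w)| ≤ B·Σ_{a∈S}|w_a|²` on a support
`S ⊆ {x + j·d (mod p) : j < N}` to the bound `B` for the twisted short character sums
`Σ_{s<2N−1} χ_p(2x+sd) e(−sk/M)`.  For `p ∤ d` these are, up to the unimodular factor `χ_p(d)·e(θy)`,
the "mixed" sums `Σ_{N'<n≤N'+H} e(θn) χ_p(n)` with `H = 2N − 1` (`norm_twistedSum_le_of_mixedBound`), for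
which a power saving beyond `√p` in the range `H ≍ p^{1/2+δ₁}` is a published theorem: Heath-Brown–Pierce,
J. LMS 91 (2015) Thm 1.4 (stated below as the named fact `BurgessBoundLinearPhase`; Burgess 1988 for
`θ = a/p`, Friedlander–Iwaniec 1993, Chang 2010).  Consequences:

* `norm_paleyForm_le_of_progression_mixed` — at one prime: a uniform bound `B` for the mixed sums of
  length `2N − 1` bounds `Q_p(S,·)` on every `S` inside a progression of length `N` with `p ∤ d`;
* `flatRIP_progression_of_burgessBoundLinearPhase` — **the engine on AP-contained supports**: assuming
  `BurgessBoundLinearPhase`, for all `κ, δ₁ > 0` with `κ + (2/3)δ₁ < 1/24` and all large primes `p`,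
  `|Q_p(S,w)| ≤ p^{1/2−κ} Σ_{a∈S}|w_a|²` for every `S ⊆ [0,p)` contained in a progression
  `{x + j·d (mod p) : j < N}`, `p ∤ d`, `N ≤ p^{1/2+δ₁}`, and every complex weight `w` (`r = 3` in the fact);
* `flatRIP_interval_of_burgessBoundLinearPhase` — the case of supports of diameter `< p^{1/2+δ₁}`.

So the registered engine, which for GENERAL supports is the Paley graph conjecture below `1/2`
(`…PaleyGraphConjecture.lean`), is a theorem in print on the class of supports of small diameter / inside a
short progression — for all weights, hence for all sub-pairs `A, B` of a short interval (correcting the line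
"arbitrary sub-pairs of an interval: open" of `Cruxes/FeketeSOSHard/Lines/paley-rip-flatRIP-census-g2.md`).
The Burgess method (Weil's bound for hyperelliptic curves + amplification) is not in Mathlib; the fact is
taken as a hypothesis, so these theorems are CONDITIONAL.

Honest framing (rung currency): Theorems-side helper `--supports` stmt-3996; the engine for general supports
(= the stub), `stub_tameOperator` and the crux stay OPEN; `VP ≠ VNP` is untouched.
-/

set_option linter.dupNamespace false

namespace Summit.ValiantsHypothesis.ValiantsHypothesis.Theorems.FeketeSOSHardPaleyRIP

open Finset Complex
open scoped BigOperators ZMod Real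

noncomputable section

/-! ## The named fact: Burgess bounds for short character sums with a linear phase -/

section Mixed

variable (p : ℕ) [Fact p.Prime]

/-- The quadratic character of `ℤ/p` with complex values. [folklore] -/
theorem legendreSym_cast_eq_ringHomComp (m : ℤ) :
    ((legendreSym p m : ℤ) : ℂ) =
      (quadraticChar (ZMod p)).ringHomComp (Int.castRingHom ℂ) (m : ZMod p) := by
  rw [MulChar.ringHomComp_apply]; rfl

/-- A sum over `N' < n ≤ N' + H` is a sum over `s < H` of the terms at `n = N' + 1 + s`. [folklore] -/
theorem sum_Ioc_eq_sum_range (f : ℤ → ℂ) (N' : ℤ) (H : ℕ) :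
    ∑ n ∈ Finset.Ioc N' (N' + H), f n = ∑ s ∈ Finset.range H, f (N' + 1 + s) := by
  induction H with
  | zero => simp
  | succ H ih =>
    rw [Finset.sum_range_succ, ← ih]
    have hdecomp : Finset.Ioc N' (N' + (H + 1 : ℕ)) = insert (N' + 1 + H) (Finset.Ioc N' (N' + H)) := by
      ext n
      simp only [Finset.mem_Ioc, Finset.mem_insert, Nat.cast_add, Nat.cast_one]
      omega
    rw [hdecomp, Finset.sum_insert, add_comm]
    simp only [Finset.mem_Ioc]; omega

/-- **Twisted progression sums are mixed character sums.**  For `p ∤ d`, `k ∈ ℤ/M` and `x ∈ ℤ` there are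
a real `θ` and an integer `N'` with
`|Σ_{s<H} χ_p(2x + s·d) e(−sk/M)| ≤ |Σ_{N'<n≤N'+H} e(θn) χ_p(n)|`
(`θ = −k/M`, `N' = y − 1` with `y·d ≡ 2x`; the two sides differ by the unimodular factor `χ_p(d)e(−θy)`).
Hence a uniform bound `B` for the mixed sums of length `H` bounds the twisted sums. [folklore] -/
theorem norm_twistedSum_le_of_mixedBound (x d : ℤ) (hd : (d : ZMod p) ≠ 0) (H : ℕ) (M : ℕ) [NeZero M]
    (k : ZMod M) (B : ℝ)
    (hmix : ∀ (θ : ℝ) (N' : ℤ), ‖∑ n ∈ Finset.Ioc N' (N' + H), Complex.exp (2 * π * I * θ * n) *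
        (quadraticChar (ZMod p)).ringHomComp (Int.castRingHom ℂ) (n : ZMod p)‖ ≤ B) :
    ‖∑ s ∈ Finset.range H, ((legendreSym p (2 * x + (s : ℤ) * d) : ℤ) : ℂ) *
        (ZMod.stdAddChar (-((s : ZMod M) * k)) : ℂ)‖ ≤ B := by
  set ψ : MulChar (ZMod p) ℂ := (quadraticChar (ZMod p)).ringHomComp (Int.castRingHom ℂ) with hψ
  -- `y` with `y·d ≡ 2x (mod p)`
  set y : ℤ := ((((2 * x : ℤ) : ZMod p) * (d : ZMod p)⁻¹).val : ℤ) with hy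
  have hyd : ((y : ℤ) : ZMod p) * (d : ZMod p) = ((2 * x : ℤ) : ZMod p) := by
    rw [hy, Int.cast_natCast, ZMod.natCast_zmod_val, mul_assoc, inv_mul_cancel₀ hd, mul_one]
  have hyd' : ((y : ℤ) : ZMod p) * (d : ZMod p) = 2 * (x : ZMod p) := by
    rw [hyd]; push_cast; ring
  -- the phase
  set θ : ℝ := -((k.val : ℝ) / M) with hθ
  have hphase : ∀ s : ℕ, (ZMod.stdAddChar (-((s : ZMod M) * k)) : ℂ) =
      Complex.exp (2 * π * I * θ * (s : ℤ)) := by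
    intro s
    have hk : (-((s : ZMod M) * k)) = ((-( (s : ℤ) * (k.val : ℤ)) : ℤ) : ZMod M) := by
      push_cast
      rw [ZMod.natCast_zmod_val]
    rw [hk, ZMod.stdAddChar_coe, hθ]
    congr 1
    have hM0 : (M : ℂ) ≠ 0 := by exact_mod_cast NeZero.ne M
    push_cast
    field_simp
  -- the character values along the progression
  have hchar : ∀ s : ℕ, ((legendreSym p (2 * x + (s : ℤ) * d) : ℤ) : ℂ) = ψ (d : ZMod p) * ψ ((y + 1 + s : ℤ) - 1 : ℤ) := by
    intro s
    rw [legendreSym_cast_eq_ringHomComp, ← hψ, ← map_mul]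
    congr 1
    push_cast
    linear_combination -hyd'
  -- rewrite the twisted sum as `ψ(d) e(−θ(y)) · Σ_{Ioc}`... we bound it directly
  have hsum : ∑ s ∈ Finset.range H, ((legendreSym p (2 * x + (s : ℤ) * d) : ℤ) : ℂ) *
      (ZMod.stdAddChar (-((s : ZMod M) * k)) : ℂ) =
      ψ (d : ZMod p) * Complex.exp (-(2 * π * I * θ * y)) *
        ∑ n ∈ Finset.Ioc (y - 1) (y - 1 + H), Complex.exp (2 * π * I * θ * n) * ψ (n : ZMod p) := by
    rw [sum_Ioc_eq_sum_range, Finset.mul_sum]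
    refine Finset.sum_congr rfl fun s _ => ?_
    rw [hchar s, hphase s]
    have hexp : Complex.exp (2 * π * I * θ * ((s : ℤ) : ℂ)) =
        Complex.exp (-(2 * π * I * θ * y)) * Complex.exp (2 * π * I * θ * ((y - 1 + 1 + s : ℤ) : ℂ)) := by
      rw [← Complex.exp_add]; congr 1; push_cast; ring
    rw [hexp]
    have : ((y + 1 + s : ℤ) - 1 : ℤ) = (y - 1 + 1 + s : ℤ) := by ring
    rw [this]; ring
  rw [hsum, norm_mul, norm_mul, Complex.norm_exp]
  have hre : (-(2 * π * I * θ * y) : ℂ).re = 0 := by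
    simp [Complex.mul_re, Complex.I_re, Complex.I_im]
  rw [hre, Real.exp_zero, mul_one]
  have hψd : ‖ψ (d : ZMod p)‖ ≤ 1 := by
    rw [hψ, MulChar.ringHomComp_apply]
    rcases quadraticChar_isQuadratic (ZMod p) (d : ZMod p) with h | h | h <;> simp [h]
  calc ‖ψ (d : ZMod p)‖ * ‖∑ n ∈ Finset.Ioc (y - 1) (y - 1 + H), Complex.exp (2 * π * I * θ * n) * ψ (n : ZMod p)‖
      ≤ 1 * B := mul_le_mul hψd (hmix θ (y - 1)) (norm_nonneg _) zero_le_one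
    _ = B := one_mul B

/-- **The engine on a progression, at one prime, from a mixed-sum bound.**  If every mixed character sum
`Σ_{N'<n≤N'+2N−1} e(θn) χ_p(n)` (`θ ∈ ℝ`, `N' ∈ ℤ`) has modulus `≤ B`, then `|Q_p(S,w)| ≤ B·Σ_{a∈S}|w_a|²`
for every `S ⊆ [0,p)` inside a progression `{x + j·d (mod p) : j < N}` with `p ∤ d` and every complex
weight `w`. [folklore] -/
theorem norm_paleyForm_le_of_progression_mixed (S : Finset ℕ) (hS : ∀ a ∈ S, a < p) (x d : ℤ)
    (hd : (d : ZMod p) ≠ 0) (N : ℕ)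
    (hAP : ∀ a ∈ S, ∃ j : ℕ, j < N ∧ ((a : ℤ) : ZMod p) = (x : ZMod p) + (j : ZMod p) * (d : ZMod p))
    (B : ℝ)
    (hmix : ∀ (θ : ℝ) (N' : ℤ), ‖∑ n ∈ Finset.Ioc N' (N' + (2 * N - 1 : ℕ)),
        Complex.exp (2 * π * I * θ * n) *
          (quadraticChar (ZMod p)).ringHomComp (Int.castRingHom ℂ) (n : ZMod p)‖ ≤ B)
    (w : ℕ → ℂ) :
    ‖paleyForm p S w‖ ≤ B * ∑ a ∈ S, ‖w a‖ ^ 2 := by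
  rcases Nat.eq_zero_or_pos N with hN | hN
  · subst hN
    have hSe : S = ∅ := Finset.eq_empty_of_forall_notMem fun a ha => by
      obtain ⟨j, hj, _⟩ := hAP a ha; omega
    subst hSe
    simp [paleyForm]
  · haveI : NeZero (2 * N - 1) := ⟨by omega⟩
    exact norm_paleyForm_le_of_progression_twisted p S hS x d N hAP (2 * N - 1) (by omega) B
      (fun k => norm_twistedSum_le_of_mixedBound p x d hd (2 * N - 1) (2 * N - 1) k B hmix) w

end Mixed

/-! ## The engine on AP-contained supports, conditionally on `BurgessBoundLinearPhase` -/

section Conditional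

/-- `C ≤ p^e` once `C^{1/e} ≤ p` (`C, e > 0`). [folklore] -/
theorem le_rpow_of_rpow_inv_le {C e : ℝ} (hC : 0 < C) (he : 0 < e) {p : ℕ} (h : C ^ (1 / e) ≤ (p : ℝ)) :
    C ≤ (p : ℝ) ^ e := by
  have h0 : (0 : ℝ) ≤ C ^ (1 / e) := Real.rpow_nonneg hC.le _
  have hmono : (C ^ (1 / e)) ^ e ≤ (p : ℝ) ^ e := Real.rpow_le_rpow h0 h he.le
  have hid : (C ^ (1 / e)) ^ e = C := by
    rw [← Real.rpow_mul hC.le, one_div, inv_mul_cancel₀ he.ne', Real.rpow_one]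
  rwa [hid] at hmono

/-- `C < p^e` once `C^{1/e} < p` (`C, e > 0`). [folklore] -/
theorem lt_rpow_of_rpow_inv_lt {C e : ℝ} (hC : 0 < C) (he : 0 < e) {p : ℕ} (h : C ^ (1 / e) < (p : ℝ)) :
    C < (p : ℝ) ^ e := by
  have h0 : (0 : ℝ) ≤ C ^ (1 / e) := Real.rpow_nonneg hC.le _
  have hmono : (C ^ (1 / e)) ^ e < (p : ℝ) ^ e := Real.rpow_lt_rpow h0 h he
  have hid : (C ^ (1 / e)) ^ e = C := by
    rw [← Real.rpow_mul hC.le, one_div, inv_mul_cancel₀ he.ne', Real.rpow_one]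
  rwa [hid] at hmono

/-- **The engine `stub_paleyFlatRIP` holds on supports inside a short arithmetic progression,
conditionally on the Burgess bound for character sums with a linear phase.**  Assume
`BurgessBoundLinearPhase` (Heath-Brown–Pierce 2015, Thm 1.4).  Then for all `κ, δ₁ > 0` with
`κ + (2/3)δ₁ < 1/24` there is `p₁` such that for every prime `p ≥ p₁`, every `S ⊆ [0,p)` contained in a
progression `{x + j·d (mod p) : j < N}` with `p ∤ d` and `N ≤ p^{1/2+δ₁}`, and every complex weight `w`,
`|Q_p(S,w)| ≤ p^{1/2−κ} · Σ_{a∈S}|w_a|²` — the registered engine inequality, with the same exponents format,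
on this support class (`r = 3` in the fact; `#S ≤ N ≤ p^{1/2+δ₁}` automatically).  CONDITIONAL on the named
fact; the Burgess method is not in Mathlib. [cite: HeathBrownPierce2015, Thm 1.4] -/
theorem flatRIP_progression_of_burgessBoundLinearPhase (hBurgess : Literature.NumberTheory.GaussSums.BurgessBoundLinearPhase)
    (κ δ₁ : ℝ) (hκ : 0 < κ) (hδ₁ : 0 < δ₁) (hgap : κ + 2 * δ₁ / 3 < 1 / 24) :
    ∃ p₁ : ℕ, ∀ (p : ℕ) [Fact p.Prime], p₁ ≤ p → ∀ (S : Finset ℕ), (∀ a ∈ S, a < p) →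
      ∀ (x d : ℤ), (d : ZMod p) ≠ 0 → ∀ (N : ℕ), (N : ℝ) ≤ (p : ℝ) ^ (1 / 2 + δ₁) →
      (∀ a ∈ S, ∃ j : ℕ, j < N ∧ ((a : ℤ) : ZMod p) = (x : ZMod p) + (j : ZMod p) * (d : ZMod p)) →
      ∀ (w : ℕ → ℂ), ‖paleyForm p S w‖ ≤ (p : ℝ) ^ (1 / 2 - κ) * ∑ a ∈ S, ‖w a‖ ^ 2 := by
  -- parameters: `r = 3`, `ε = g/2` where `g` is the gap in `κ + (2/3)δ₁ < 1/24`
  set g : ℝ := 1 / 24 - κ - 2 * δ₁ / 3 with hg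
  have hgpos : 0 < g := by rw [hg]; linarith
  set ε : ℝ := g / 2 with hε
  have hεpos : 0 < ε := by rw [hε]; linarith
  obtain ⟨C, hC, hB⟩ := hBurgess 3 (by norm_num) ε hεpos
  set C' : ℝ := C * (2 : ℝ) ^ (2 / 3 : ℝ) with hC'
  have hC'pos : 0 < C' := mul_pos hC (Real.rpow_pos_of_pos (by norm_num) _)
  set t : ℝ := 1 / 8 - δ₁ with ht
  have htpos : 0 < t := by rw [ht]; linarith
  refine ⟨⌈(2 : ℝ) ^ (1 / t)⌉₊ + ⌈C' ^ (1 / ε)⌉₊ + 3, ?_⟩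
  intro p _ hp S hS x d hd N hN hAP w
  have hp3 : 3 ≤ p := le_trans (by omega) hp
  have hp2 : p ≠ 2 := by omega
  have hp0 : (0 : ℝ) < (p : ℝ) := by exact_mod_cast (Fact.out : p.Prime).pos
  have hpR : ((⌈(2 : ℝ) ^ (1 / t)⌉₊ + ⌈C' ^ (1 / ε)⌉₊ + 3 : ℕ) : ℝ) ≤ (p : ℝ) := by exact_mod_cast hp
  push_cast at hpR
  -- `2 < p^t` and `C' ≤ p^ε`
  have h2t : (2 : ℝ) < (p : ℝ) ^ t := by
    refine lt_rpow_of_rpow_inv_lt (by norm_num) htpos ?_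
    have := Nat.le_ceil ((2 : ℝ) ^ (1 / t)); linarith
  have hC'le : C' ≤ (p : ℝ) ^ ε := by
    refine le_rpow_of_rpow_inv_le hC'pos hεpos ?_
    have := Nat.le_ceil (C' ^ (1 / ε)); linarith
  -- the quadratic character is non-principal
  have hψ : (quadraticChar (ZMod p)).ringHomComp (Int.castRingHom ℂ) ≠ 1 :=
    Literature.NumberTheory.GaussSums.quadraticChar_ringHomComp_ne_one hp2
  -- the mixed-sum bound at length `H = 2N − 1`
  refine norm_paleyForm_le_of_progression_mixed p S hS x d hd N hAP _ (fun θ N' => ?_) w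
  have hH2 : ((2 * N - 1 : ℕ) : ℝ) ≤ 2 * (N : ℝ) := by
    have : (2 * N - 1 : ℕ) ≤ 2 * N := Nat.sub_le _ _
    exact_mod_cast this
  have hH : ((2 * N - 1 : ℕ) : ℝ) ≤ 2 * (p : ℝ) ^ (1 / 2 + δ₁) := hH2.trans (by linarith)
  have hpow : (0 : ℝ) < (p : ℝ) ^ (1 / 2 + δ₁) := Real.rpow_pos_of_pos hp0 _
  -- range condition `H < p^{5/8}`
  have hrange : ((2 * N - 1 : ℕ) : ℝ) < (p : ℝ) ^ (1 / 2 + 1 / (4 * (((3 : ℕ) : ℝ) - 1))) := by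
    have h58 : (1 : ℝ) / 2 + 1 / (4 * (((3 : ℕ) : ℝ) - 1)) = t + (1 / 2 + δ₁) := by
      rw [ht]; norm_num
    rw [h58, Real.rpow_add hp0]
    calc ((2 * N - 1 : ℕ) : ℝ) ≤ 2 * (p : ℝ) ^ (1 / 2 + δ₁) := hH
      _ < (p : ℝ) ^ t * (p : ℝ) ^ (1 / 2 + δ₁) := mul_lt_mul_of_pos_right h2t hpow
  have hmain := hB p _ hψ θ N' (2 * N - 1) hrange
  refine hmain.trans ?_
  have h23 : (1 : ℝ) - 1 / ((3 : ℕ) : ℝ) = 2 / 3 := by norm_num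
  have h18 : 1 / (4 * (((3 : ℕ) : ℝ) - 1)) + ε = 1 / 8 + ε := by norm_num
  rw [h23, h18]
  -- `C · H^{2/3} · p^{1/8+ε} ≤ C' · p^{1/2−κ−ε} ≤ p^{1/2−κ}`
  have hH0 : (0 : ℝ) ≤ ((2 * N - 1 : ℕ) : ℝ) := Nat.cast_nonneg _
  have hHpow : ((2 * N - 1 : ℕ) : ℝ) ^ (2 / 3 : ℝ) ≤
      (2 : ℝ) ^ (2 / 3 : ℝ) * (p : ℝ) ^ ((1 / 2 + δ₁) * (2 / 3)) := by
    calc ((2 * N - 1 : ℕ) : ℝ) ^ (2 / 3 : ℝ) ≤ (2 * (p : ℝ) ^ (1 / 2 + δ₁)) ^ (2 / 3 : ℝ) :=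
          Real.rpow_le_rpow hH0 hH (by norm_num)
      _ = (2 : ℝ) ^ (2 / 3 : ℝ) * ((p : ℝ) ^ (1 / 2 + δ₁)) ^ (2 / 3 : ℝ) :=
          Real.mul_rpow (by norm_num) hpow.le
      _ = (2 : ℝ) ^ (2 / 3 : ℝ) * (p : ℝ) ^ ((1 / 2 + δ₁) * (2 / 3)) := by
          rw [← Real.rpow_mul hp0.le]
  have hexp : (1 / 2 + δ₁) * (2 / 3) + (1 / 8 + ε) = (1 / 2 - κ) - ε := by
    rw [hε, hg]; ring
  have hpε : (0 : ℝ) < (p : ℝ) ^ ε := Real.rpow_pos_of_pos hp0 _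
  have hp18 : (0 : ℝ) ≤ (p : ℝ) ^ (1 / 8 + ε) := Real.rpow_nonneg hp0.le _
  calc C * ((2 * N - 1 : ℕ) : ℝ) ^ (2 / 3 : ℝ) * (p : ℝ) ^ (1 / 8 + ε)
      ≤ C * ((2 : ℝ) ^ (2 / 3 : ℝ) * (p : ℝ) ^ ((1 / 2 + δ₁) * (2 / 3))) * (p : ℝ) ^ (1 / 8 + ε) :=
        mul_le_mul_of_nonneg_right (mul_le_mul_of_nonneg_left hHpow hC.le) hp18
    _ = C' * (p : ℝ) ^ ((1 / 2 + δ₁) * (2 / 3) + (1 / 8 + ε)) := by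
        have hsplit : (p : ℝ) ^ ((1 / 2 + δ₁) * (2 / 3) + (1 / 8 + ε)) =
            (p : ℝ) ^ ((1 / 2 + δ₁) * (2 / 3)) * (p : ℝ) ^ (1 / 8 + ε) := Real.rpow_add hp0 _ _
        rw [hsplit, hC']; ring
    _ = C' * ((p : ℝ) ^ (1 / 2 - κ) / (p : ℝ) ^ ε) := by
        rw [hexp, Real.rpow_sub hp0]
    _ ≤ (p : ℝ) ^ ε * ((p : ℝ) ^ (1 / 2 - κ) / (p : ℝ) ^ ε) :=
        mul_le_mul_of_nonneg_right hC'le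
          (div_nonneg (Real.rpow_nonneg hp0.le _) (Real.rpow_nonneg hp0.le _))
    _ = (p : ℝ) ^ (1 / 2 - κ) := by
        field_simp

/-- **Interval / small-diameter case.**  Assuming `BurgessBoundLinearPhase`: for all `κ, δ₁ > 0` with
`κ + (2/3)δ₁ < 1/24` and all large primes `p`, every `S ⊆ [x, x+N) ⊆ [0,p)` with `N ≤ p^{1/2+δ₁}`
satisfies `|Q_p(S,w)| ≤ p^{1/2−κ} Σ_{a∈S}|w_a|²` for every complex weight `w` — in particular the flat
Paley-sum discrepancy `|Σ_{A×B} χ_p(a+b)| ≤ p^{1/2−κ}√(#A#B)` for ALL sub-pairs `A, B` of a short interval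
(via `…FlatRIPPolarisation`).  CONDITIONAL on the named fact. [cite: HeathBrownPierce2015, Thm 1.4] -/
theorem flatRIP_interval_of_burgessBoundLinearPhase (hBurgess : Literature.NumberTheory.GaussSums.BurgessBoundLinearPhase)
    (κ δ₁ : ℝ) (hκ : 0 < κ) (hδ₁ : 0 < δ₁) (hgap : κ + 2 * δ₁ / 3 < 1 / 24) :
    ∃ p₁ : ℕ, ∀ (p : ℕ) [Fact p.Prime], p₁ ≤ p → ∀ (S : Finset ℕ), (∀ a ∈ S, a < p) →
      ∀ (x N : ℕ), (N : ℝ) ≤ (p : ℝ) ^ (1 / 2 + δ₁) → (∀ a ∈ S, x ≤ a ∧ a < x + N) →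
      ∀ (w : ℕ → ℂ), ‖paleyForm p S w‖ ≤ (p : ℝ) ^ (1 / 2 - κ) * ∑ a ∈ S, ‖w a‖ ^ 2 := by
  obtain ⟨p₁, h⟩ := flatRIP_progression_of_burgessBoundLinearPhase hBurgess κ δ₁ hκ hδ₁ hgap
  refine ⟨p₁, fun p _ hp S hS x N hN hI w => h p hp S hS (x : ℤ) 1 ?_ N hN ?_ w⟩
  · rw [Int.cast_one]; exact one_ne_zero
  · intro a ha
    refine ⟨a - x, by have := hI a ha; omega, ?_⟩
    have hle := (hI a ha).1
    have : (a : ℤ) = (x : ℤ) + ((a - x : ℕ) : ℤ) * 1 := by push_cast [Nat.cast_sub hle]; ring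
    rw [this]; push_cast; ring

end Conditional

/-! ## Flat Paley-sum discrepancy for ALL sub-pairs of a short interval (appended) -/

section SubPairs

/-- **All sub-pairs of a short interval are flat, conditionally on `BurgessBoundLinearPhase`.**  For
`κ, δ₁ > 0` with `κ + (2/3)δ₁ < 1/24` and all large primes `p`: for every interval `[x, x+N) ⊆ [0,p)` with
`N ≤ p^{1/2+δ₁}` and ALL `A, B ⊆ [x, x+N)`, `|Σ_{a∈A, b∈B} χ_p(a+b)| ≤ p^{1/2−κ}·√(#A·#B)` — the bilinear
Paley-sum bound beyond `√p` in the balanced range `#A, #B ≍ p^{1/2+δ₁}` for arbitrary sub-pairs of a short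
interval (the census line "arbitrary sub-pairs of an interval: open" corrected: operator-norm bound of
`flatRIP_interval_of_burgessBoundLinearPhase` + polarisation `norm_charSum_le_of_quad`).  CONDITIONAL on the
named fact (Heath-Brown–Pierce 2015, Thm 1.4). [cite: HeathBrownPierce2015, Thm 1.4] -/
theorem charSum_subpairs_interval_of_burgessBoundLinearPhase
    (hBurgess : Literature.NumberTheory.GaussSums.BurgessBoundLinearPhase)
    (κ δ₁ : ℝ) (hκ : 0 < κ) (hδ₁ : 0 < δ₁) (hgap : κ + 2 * δ₁ / 3 < 1 / 24) :
    ∃ p₁ : ℕ, ∀ (p : ℕ) [Fact p.Prime], p₁ ≤ p → ∀ (x N : ℕ), x + N ≤ p →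
      (N : ℝ) ≤ (p : ℝ) ^ (1 / 2 + δ₁) → ∀ (A B : Finset ℕ), A ⊆ Finset.Ico x (x + N) →
      B ⊆ Finset.Ico x (x + N) →
      ‖∑ a ∈ A, ∑ b ∈ B, ((legendreSym p ((a : ℤ) + b) : ℤ) : ℂ)‖ ≤
        (p : ℝ) ^ (1 / 2 - κ) * Real.sqrt ((A.card : ℝ) * B.card) := by
  obtain ⟨p₁, h⟩ := flatRIP_interval_of_burgessBoundLinearPhase hBurgess κ δ₁ hκ hδ₁ hgap
  refine ⟨p₁, fun p _ hp x N hxN hN A B hA hB => ?_⟩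
  have hS : ∀ a ∈ Finset.Ico x (x + N), a < p := fun a ha => by
    have := (Finset.mem_Ico.1 ha).2; omega
  have hI : ∀ a ∈ Finset.Ico x (x + N), x ≤ a ∧ a < x + N := fun a ha => Finset.mem_Ico.1 ha
  exact norm_charSum_le_of_quad p _ (Finset.Ico x (x + N)) (h p hp _ hS x N hN hI) A B hA hB

end SubPairs

end

end Summit.ValiantsHypothesis.ValiantsHypothesis.Theorems.FeketeSOSHardPaleyRIP
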